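import Literature.MathematicalPhysics.QuantumFieldTheory.Balaban1983to89.B9Eq3152ThirdWordPiTwoBackgroundGradLetterOfOmegaHolder
import Literature.MathematicalPhysics.QuantumFieldTheory.Balaban1983to89.B11Eq117FrakGkPiLetterDefectAtFlatOfGradRow

/-!
# `Balaban1983to89.B11Eq117FrakGkPiLetterDefectAtFlatOfOmegaHolder` — T. Bałaban, CMP **102** (1985) [Balaban1985Variational] (115)–(117) pp. 294–295 with [Balaban1985BackgroundPropagators] (3.153): **`δ̃_G` OF (117) FOR PRINT's `𝔊̃_k` AT THE FLAT POINT, LATTICE-FREE, MODULO `Hω`.**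
# The displayed letter `H3` of gen 102 is replaced by the FIRST-ORDER letter `Hω` (η-scale ½-Hölder row of `ω(U) − ω(1)`, `ω = R_kG′_kD*_Uf`, with the small factor) through this
# generation's `B9Eq3152ThirdWordPiTwoBackgroundGradLetterOfOmegaHolder.exists_gradLetter_thirdWordPi_sub_flat_of_omegaHolder` (`Hω → H3`): pure composition BY NAME of gen 102's
# `B11Eq117FrakGkPiLetterDefectAtFlatOfGradRow` with it; statements VERBATIM.  NE9 crux-team LEAF PROVER 01 (`b2b-balaban-t4-ne9-formalise-leaf-01`), gen 103; audit cell `pub-balaban`,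
# sub-cell `t4`, BINDER row NE9, bears_on R4/N22.  [folklore] composition; source pages as in the two composed files.

statement-level skeleton of published theorems with citation tags; proofs where landed; nothing here is a claim about the Yang–Mills mass gap

WHAT IS PROVED (sorry-free; proof lane — 0 `def`): `exists_frakGkPi_letterDefect_at_flat_of_omegaHolder`.
HONEST SCOPE.  CONDITIONAL on `Hω` (the located FIRST-ORDER two-background letter: η-scale ½-Hölder ladder of `R_kG′_kD*_U`; NOT in the tree); composition BY NAME on the cell's
MODEL rows (O-NE9-1, #5 UNRULED); constants crude; nothing of [B9]∕[B11] asserted as printed; «NE9 ⇐ the named binders»; NE9 NOT PRINTED ∕ NOT PROVED; spine PROVED 0∕9; rung (B)+1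
finite T⁴ — NOT infinite volume, NOT mass gap, NOT BetaPertH, NOT Clay.  HONEST DEPENDENCY: continuum YM on T⁴ ⇐ BetaPertH ∧ nine spine estimates (0/9 proved); BetaPertH ⇐ (D1) ∧
(D4) ∧ CAP+tail; G-an2-4 gates asym, D1 and NE2/3/4.  NEW file; nothing modified.  Net new unproved facts: 0.
-/

noncomputable section

open scoped InnerProductSpace ComplexConjugate BigOperators

namespace Literature.MathematicalPhysics.QuantumFieldTheory.Balaban1983to89.B11Eq117FrakGkPiLetterDefectAtFlatOfOmegaHolder

open B4Sect5Torus (TSite tdist)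
open B9SectCLatticeCarrier (Bond bpos btgt shift unshift)
open B9Eq319QprimeTorus (blockCoord)
open B9Eq316TowerFlatIsOneStep (towerP_eq_fineP_pow siteCast)
open B9Eq311L2Pairing (WL2)
open B7Prop1Explicit (U1 Wcx boxVec)
open B11Eq103H1Complex (SiteL2K BondL2K covDerivL2K covDivL2K G1LatticeK KinvLatticeK frakGLatticeK frakGLatticeCLM readFun)
open B11Eq115Space (NegSize Space115 levWeight NegSup JetSup)
open B11Eq111FrakG (nabla115 jetLinearEquiv toCLM115 toCLM115_apply)
open B9Eq33CovDerivVector (covGrad)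
open B9Eq310DeltaPrime (plaqHolU)
open B9Eq310HessianOperator (adTransportW hessOp)
open B9Eq315QTorus (perCfg cornerSite)
open B9Eq315QTower (towerP UlevOf)
open B9Eq315QTowerFlat (perCfg_UlevOf_one_mem_U1 norm_Wcx_UlevOf_one_sub_one_le)
open B9Eq326OperatorTower (laplaceAk QkW RofUk G1k)
open B9Eq324DeltaPrimeATower (laplacePrimeAk GpOfUk)
open B11Eq117LetterDefects (jetId_frakG_eq_toCLM115_readFun frakG_eq_toCLM115_readFun readFun_sub)
open B11Eq117ReadLettersBridge (norm_toCLM115_readFun_le_of_global)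
open B9Eq3119DeltaPiTower (laplaceAkPi)
open B9Eq3153FrakGkPiTwoBackgroundLetterTower (exists_supRow_frakGkPi_sub_flat)
open B9Eq3153FrakGkPiTwoBackgroundGradientRowOfThirdWord (exists_supGradRow_frakGkPi_sub_flat_of_thirdWord)
open B9Eq3152ThirdWordPiTwoBackgroundGradLetterOfOmegaHolder (exists_gradLetter_thirdWordPi_sub_flat_of_omegaHolder)
open B11Eq117FrakGkPiLetterDefectAtFlatOfGradRow (exists_frakGkPi_letterDefect_at_flat_of_thirdWordGradLetter)

variable {d : ℕ} (hd : 1 ≤ d) (L : ℕ) [NeZero L] (hL : 1 ≤ L) (hL3 : 3 ≤ L)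
  {𝔸 : Type*} [NormedRing 𝔸] [NormedAlgebra ℂ 𝔸] [CompleteSpace 𝔸] [NormOneClass 𝔸] [StarRing 𝔸] [NormedStarGroup 𝔸] [StarModule ℂ 𝔸] [FiniteDimensional ℂ 𝔸]
  {W : Type*} [NormedAddCommGroup W] [InnerProductSpace ℂ W] [FiniteDimensional ℂ W] (φ : W ≃ₗ[ℂ] 𝔸)
  {Mφ Mφ' : ℝ} (hMφ : 0 ≤ Mφ) (hMφ' : 0 ≤ Mφ') (hφ : ∀ w, ‖φ w‖ ≤ Mφ * ‖w‖) (hφ' : ∀ X, ‖φ.symm X‖ ≤ Mφ' * ‖X‖) (hstar : ∀ X : 𝔸, ‖star X‖ ≤ ‖X‖)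
  {a : ℝ} (ha : 0 < a) {a' : ℝ} (ha' : 0 < a') {ϱ : ℝ} (hϱ0 : 0 ≤ ϱ) (hϱ1 : ϱ < 1)
  (τ : 𝔸 →ₗ[ℂ] ℂ) {Cτ : ℝ} (hτ : ∀ X, ‖τ X‖ ≤ Cτ * ‖X‖) (hCτ : 0 ≤ Cτ) {Mτ : ℝ} (hτm : ∀ X Y : 𝔸, ‖τ (X * Y)‖ ≤ Mτ * ‖X‖ * ‖Y‖) (hMτ : 0 ≤ Mτ)
  {ρw : ℝ} (hρw : 0 ≤ ρw)
  (hτ₁ : ∀ X : 𝔸, τ (star X) = conj (τ X)) (hτ₂ : ∀ X Y : 𝔸, τ (X * Y) = τ (Y * X)) (hφτ : ∀ X Y : 𝔸, ⟪φ.symm X, φ.symm Y⟫_ℂ = τ (star X * Y))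
  (AQ : ℝ)
  {ι : Type} [Fintype ι] [DecidableEq ι] (b : Module.Basis ι ℝ 𝔸) {M₂ : ℝ} (hM₂ : 0 ≤ M₂) (hrepr : ∀ (v : 𝔸) (i : ι), |b.repr v i| ≤ M₂ * ‖v‖)

include hd hL hL3 hMφ hMφ' hφ hφ' hstar ha ha' hϱ0 hϱ1 hτ hCτ hτm hMτ hρw hτ₁ hτ₂ hφτ hM₂ hrepr in
set_option maxHeartbeats 3200000 in
set_option maxRecDepth 8192 in
/-- **`exists_frakGkPi_letterDefect_at_flat_of_thirdWordGradLetter` MODULO `Hω` INSTEAD OF `H3`** (statement verbatim). [folklore]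
[cite: Balaban1985Variational, Prop. 6 (116)–(121) p.295, (117) p.295, (174)–(175) p.305, Prop. 9 p.309; Balaban1985BackgroundPropagators, Thm 3.4 p.400, (3.122) p.420] -/
theorem exists_frakGkPi_letterDefect_at_flat_of_omegaHolder [Fact (0 < (L : ℝ))]
    (Hω : ∃ α₁ j₁ K κ : ℝ, 0 < α₁ ∧ 0 < j₁ ∧ 0 ≤ K ∧ 0 < κ ∧
      ∀ (n : ℕ) (η : ℝ) (_hηL : η * (L : ℝ) ^ (n + 1) = 1) (c₀ c₁ : ℝ) [Fact (0 < c₀)] [Fact (0 < c₁)]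
        (_hw : c₀ * ((L : ℝ) ^ (n + 1)) ^ d = c₁) (_hρ : |η| ^ d / c₀ ≤ ρw) (m : Fin d → ℕ) [∀ i, NeZero (m i)] (_hm : ∀ i, 1 ≤ m i)
        (U : Bond d (towerP L m (n + 1)) → 𝔸ˣ) (αU : ℕ → ℝ) (_hα0 : ∀ j, 0 ≤ αU j) (hα1 : ∀ j, αU j ≤ 1 / 64)
        (_hαL : ∀ j, 50 * (d + 1) * αU j * (L : ℝ) ^ d ≤ 1 / 2)
        (hU1 : ∀ (j : ℕ) (x : B7Prop1Explicit.Site d) (k : Fin d), perCfg (towerP L m (j + 1)) (UlevOf L m (n + 1) U j) x k ∈ U1 𝔸)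
        (hreg : ∀ (j : ℕ) (y : TSite d (towerP L m j)) (k : Fin d) (ρ' : Fin d → Fin L),
          ‖((Wcx L (perCfg (towerP L m (j + 1)) (UlevOf L m (n + 1) U j)) (cornerSite L y) k (boxVec L ρ') : 𝔸ˣ) : 𝔸) - 1‖ ≤ αU j)
        (εU : ℕ → ℝ) (_hεU : ∀ j, 0 ≤ εU j) (_hε1 : ∀ j, εU j ≤ 1) (_hUε : ∀ (j : ℕ) (b : Bond d (towerP L m (j + 1))), ‖(UlevOf L m (n + 1) U j b : 𝔸) - 1‖ ≤ εU j)
        (_hLb : ∀ (j : ℕ) (b : Bond d (towerP L m (j + 1))), UlevOf L m (n + 1) U j b ∈ U1 𝔸)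
        (α : ℝ) (_hα : 0 ≤ α) (_hαle : α ≤ α₁)
        (hUst : ∀ b, star (U b : 𝔸) = (((U b)⁻¹ : 𝔸ˣ) : 𝔸)) (_hUb : ∀ b, U b ∈ U1 𝔸) (_hUη : ∀ b, ‖(U b : 𝔸) - 1‖ ≤ α * η)
        (_hUw : ∀ (x : TSite d (towerP L m (n + 1))) (μ ν : Fin d), ‖(U (shift ν x, μ) : 𝔸) - (U (x, μ) : 𝔸)‖ ≤ α * η ^ 2)
        (_hpl : ∀ p : B9SectCLatticeCarrier.Plaq d (towerP L m (n + 1)), ‖(plaqHolU U p : 𝔸) - 1‖ ≤ α * η ^ 2)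
        (_hUgrad : ∀ (x : TSite d (towerP L m (n + 1))) (μ : Fin d), ‖(U (x, μ) : 𝔸) - U (unshift μ x, μ)‖ ≤ α * η ^ 2)
        (_hRlev : ∀ (j : ℕ) (b : Bond d (towerP L m (j + 1))) (w : W), ‖adTransportW φ (UlevOf L m (n + 1) U j) b w‖ ≤ ‖w‖)
        (_hεg : ∀ j < n + 1, εU j ≤ α * ϱ ^ j) (_hAQ : ∑ j ∈ Finset.range (n + 1), αU j ≤ AQ)
        (hpos' : ∀ x : SiteL2K ℂ d (towerP L m (n + 1)) c₀ W, x ≠ 0 → 0 < RCLike.re ⟪x, laplacePrimeAk L m n φ η U a' (c₁ := c₁) x⟫_ℂ)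
        (hpos : ∀ x : BondL2K ℂ d (towerP L m (n + 1)) c₀ W, x ≠ 0 →
          0 < RCLike.re ⟪x, laplaceAk L m n φ η U hL αU hα1 hU1 hreg τ (c₀ := c₀) (c₁ := c₁) a x⟫_ℂ)
        (_hc₀η : c₀ = η ^ d) (j₀ : ℝ) (_hJ : ∀ μ y, ‖B9Eq39Adjoint.J (fun μ => B9Eq33CovDerivVector.shiftEquiv μ) (fun μ y => U (y, μ)) η μ y‖ ≤ j₀) (_hj : j₀ ≤ j₁)
        (hposπ : ∀ x : BondL2K ℂ d (towerP L m (n + 1)) c₀ W, x ≠ 0 →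
          0 < RCLike.re ⟪x, laplaceAkPi L m n φ τ η U a' hpos' hL αU hα1 hU1 hreg (c₁ := c₁) a x⟫_ℂ)
        (_hQ : Function.Surjective (QkW L m n φ U hL αU hα1 hU1 hreg (c₀ := c₀) (c₁ := c₁)))
        (hpos'₁ : ∀ x : SiteL2K ℂ d (towerP L m (n + 1)) c₀ W, x ≠ 0 →
          0 < RCLike.re ⟪x, laplacePrimeAk L m n φ η (fun _ : Bond d (towerP L m (n + 1)) => (1 : 𝔸ˣ)) a' (c₁ := c₁) x⟫_ℂ)
        (hpos₁ : ∀ x : BondL2K ℂ d (towerP L m (n + 1)) c₀ W, x ≠ 0 →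
          0 < RCLike.re ⟪x, laplaceAk L m n φ η (fun _ : Bond d (towerP L m (n + 1)) => (1 : 𝔸ˣ)) hL (fun _ => 0) (fun _ => by norm_num)
            (perCfg_UlevOf_one_mem_U1 L m (n + 1)) (norm_Wcx_UlevOf_one_sub_one_le L m (n + 1) (fun _ => 0) (fun _ => le_rfl)) τ
            (c₀ := c₀) (c₁ := c₁) a x⟫_ℂ)
        (v : TSite d m) (f : BondL2K ℂ d (towerP L m (n + 1)) c₀ W) (F : ℝ)
        (_hfv : ∀ b', blockCoord (L ^ (n + 1)) m (siteCast (towerP_eq_fineP_pow L m (n + 1)) (bpos b')) ≠ v → WL2.equiv ℂ (fun _ : Bond d (towerP L m (n + 1)) => c₀) W f b' = 0)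
        (_hfF : ∀ b', ‖WL2.equiv ℂ (fun _ : Bond d (towerP L m (n + 1)) => c₀) W f b'‖ ≤ F) (y y' : TSite d (towerP L m (n + 1)))
        (_hyy : tdist (towerP L m (n + 1)) y y' ≤ (L : ℝ) ^ (n + 1)),
        ‖WL2.equiv ℂ (fun _ : TSite d (towerP L m (n + 1)) => c₀) W
            (RofUk L m n φ η U (c₀ := c₀) (GpOfUk L m n φ η U a' (c₁ := c₁) hpos' (covDivL2K ℂ c₀ ((η : ℂ))⁻¹ (adTransportW φ fun bb => (U bb)⁻¹) f)) -
              RofUk L m n φ η (fun _ : Bond d (towerP L m (n + 1)) => (1 : 𝔸ˣ)) (c₀ := c₀)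
                (GpOfUk L m n φ η (fun _ : Bond d (towerP L m (n + 1)) => (1 : 𝔸ˣ)) a' (c₁ := c₁) hpos'₁
                  (covDivL2K ℂ c₀ ((η : ℂ))⁻¹ (adTransportW φ fun bb => ((fun _ : Bond d (towerP L m (n + 1)) => (1 : 𝔸ˣ)) bb)⁻¹) f))) y' -
          WL2.equiv ℂ (fun _ : TSite d (towerP L m (n + 1)) => c₀) W
            (RofUk L m n φ η U (c₀ := c₀) (GpOfUk L m n φ η U a' (c₁ := c₁) hpos' (covDivL2K ℂ c₀ ((η : ℂ))⁻¹ (adTransportW φ fun bb => (U bb)⁻¹) f)) -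
              RofUk L m n φ η (fun _ : Bond d (towerP L m (n + 1)) => (1 : 𝔸ˣ)) (c₀ := c₀)
                (GpOfUk L m n φ η (fun _ : Bond d (towerP L m (n + 1)) => (1 : 𝔸ˣ)) a' (c₁ := c₁) hpos'₁
                  (covDivL2K ℂ c₀ ((η : ℂ))⁻¹ (adTransportW φ fun bb => ((fun _ : Bond d (towerP L m (n + 1)) => (1 : 𝔸ˣ)) bb)⁻¹) f))) y‖ ≤
          (j₀ + α) * K * Real.exp (-(κ * tdist m (blockCoord (L ^ (n + 1)) m (siteCast (towerP_eq_fineP_pow L m (n + 1)) y)) v)) *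
            (tdist (towerP L m (n + 1)) y y' / (L : ℝ) ^ (n + 1)) ^ ((1 : ℝ) / 2) * F) :
    ∃ α₁ j₁ K KD : ℝ, 0 < α₁ ∧ 0 < j₁ ∧ 0 ≤ K ∧ 0 ≤ KD ∧
      ∀ (n : ℕ) (η : ℝ) [Fact (0 < η)] (_hηL : η * (L : ℝ) ^ (n + 1) = 1) (c₀ c₁ : ℝ) [Fact (0 < c₀)] [Fact (0 < c₁)]
        (_hw : c₀ * ((L : ℝ) ^ (n + 1)) ^ d = c₁) (_hρ : |η| ^ d / c₀ ≤ ρw) (m : Fin d → ℕ) [∀ i, NeZero (m i)] (_hm : ∀ i, 1 ≤ m i)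
        (U : Bond d (towerP L m (n + 1)) → 𝔸ˣ) (αU : ℕ → ℝ) (_hα0 : ∀ j, 0 ≤ αU j) (hα1 : ∀ j, αU j ≤ 1 / 64)
        (_hαL : ∀ j, 50 * (d + 1) * αU j * (L : ℝ) ^ d ≤ 1 / 2)
        (hU1 : ∀ (j : ℕ) (x : B7Prop1Explicit.Site d) (k : Fin d), perCfg (towerP L m (j + 1)) (UlevOf L m (n + 1) U j) x k ∈ U1 𝔸)
        (hreg : ∀ (j : ℕ) (y : TSite d (towerP L m j)) (k : Fin d) (ρ' : Fin d → Fin L),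
          ‖((Wcx L (perCfg (towerP L m (j + 1)) (UlevOf L m (n + 1) U j)) (cornerSite L y) k (boxVec L ρ') : 𝔸ˣ) : 𝔸) - 1‖ ≤ αU j)
        (εU : ℕ → ℝ) (_hεU : ∀ j, 0 ≤ εU j) (_hε1 : ∀ j, εU j ≤ 1) (_hUε : ∀ (j : ℕ) (b : Bond d (towerP L m (j + 1))), ‖(UlevOf L m (n + 1) U j b : 𝔸) - 1‖ ≤ εU j)
        (_hLb : ∀ (j : ℕ) (b : Bond d (towerP L m (j + 1))), UlevOf L m (n + 1) U j b ∈ U1 𝔸)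
        (α : ℝ) (_hα : 0 ≤ α) (_hαle : α ≤ α₁)
        (hUst : ∀ b, star (U b : 𝔸) = (((U b)⁻¹ : 𝔸ˣ) : 𝔸)) (_hUb : ∀ b, U b ∈ U1 𝔸) (_hUη : ∀ b, ‖(U b : 𝔸) - 1‖ ≤ α * η)
        (_hUw : ∀ (x : TSite d (towerP L m (n + 1))) (μ ν : Fin d), ‖(U (shift ν x, μ) : 𝔸) - (U (x, μ) : 𝔸)‖ ≤ α * η ^ 2)
        (_hpl : ∀ p : B9SectCLatticeCarrier.Plaq d (towerP L m (n + 1)), ‖(plaqHolU U p : 𝔸) - 1‖ ≤ α * η ^ 2)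
        (_hUgrad : ∀ (x : TSite d (towerP L m (n + 1))) (μ : Fin d), ‖(U (x, μ) : 𝔸) - U (unshift μ x, μ)‖ ≤ α * η ^ 2)
        (_hRlev : ∀ (j : ℕ) (b : Bond d (towerP L m (j + 1))) (w : W), ‖adTransportW φ (UlevOf L m (n + 1) U j) b w‖ ≤ ‖w‖)
        (_hεg : ∀ j < n + 1, εU j ≤ α * ϱ ^ j) (_hAQ : ∑ j ∈ Finset.range (n + 1), αU j ≤ AQ)
        (hpos' : ∀ x : SiteL2K ℂ d (towerP L m (n + 1)) c₀ W, x ≠ 0 → 0 < RCLike.re ⟪x, laplacePrimeAk L m n φ η U a' (c₁ := c₁) x⟫_ℂ)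
        (hpos : ∀ x : BondL2K ℂ d (towerP L m (n + 1)) c₀ W, x ≠ 0 →
          0 < RCLike.re ⟪x, laplaceAk L m n φ η U hL αU hα1 hU1 hreg τ (c₀ := c₀) (c₁ := c₁) a x⟫_ℂ)
        (_hc₀η : c₀ = η ^ d) (j₀ : ℝ) (_hJ : ∀ μ y, ‖B9Eq39Adjoint.J (fun μ => B9Eq33CovDerivVector.shiftEquiv μ) (fun μ y => U (y, μ)) η μ y‖ ≤ j₀) (_hj : j₀ ≤ j₁)
        (hposπ : ∀ x : BondL2K ℂ d (towerP L m (n + 1)) c₀ W, x ≠ 0 →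
          0 < RCLike.re ⟪x, laplaceAkPi L m n φ τ η U a' hpos' hL αU hα1 hU1 hreg (c₁ := c₁) a x⟫_ℂ)
        (hQ : Function.Surjective (QkW L m n φ U hL αU hα1 hU1 hreg (c₀ := c₀) (c₁ := c₁)))
        (hpos'₁ : ∀ x : SiteL2K ℂ d (towerP L m (n + 1)) c₀ W, x ≠ 0 →
          0 < RCLike.re ⟪x, laplacePrimeAk L m n φ η (fun _ : Bond d (towerP L m (n + 1)) => (1 : 𝔸ˣ)) a' (c₁ := c₁) x⟫_ℂ)
        (hpos₁ : ∀ x : BondL2K ℂ d (towerP L m (n + 1)) c₀ W, x ≠ 0 →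
          0 < RCLike.re ⟪x, laplaceAk L m n φ η (fun _ : Bond d (towerP L m (n + 1)) => (1 : 𝔸ˣ)) hL (fun _ => 0) (fun _ => by norm_num)
            (perCfg_UlevOf_one_mem_U1 L m (n + 1)) (norm_Wcx_UlevOf_one_sub_one_le L m (n + 1) (fun _ => 0) (fun _ => le_rfl)) τ
            (c₀ := c₀) (c₁ := c₁) a x⟫_ℂ)
        (hQ1 : Function.Surjective (QkW L m n φ (fun _ : Bond d (towerP L m (n + 1)) => (1 : 𝔸ˣ)) hL (fun _ => 0) (fun _ => by norm_num)
          (perCfg_UlevOf_one_mem_U1 L m (n + 1)) (norm_Wcx_UlevOf_one_sub_one_le L m (n + 1) (fun _ => 0) (fun _ => le_rfl)) (c₀ := c₀) (c₁ := c₁)))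
        (lev₀ : Bond d (towerP L m (n + 1)) → ℕ) (lev₁ : Bond d (towerP L m (n + 1)) × Fin d → ℕ),
        ∀ f : NegSize (L : ℝ) η lev₀ 3 𝔸,
          ‖LinearMap.toContinuousLinearMap
              ((jetLinearEquiv (L : ℝ) η lev₀ lev₁ (nabla115 η (fun _ : Bond d (towerP L m (n + 1)) => (1 : 𝔸ˣ)))).symm.toLinearMap ∘ₗ
                (jetLinearEquiv (L : ℝ) η lev₀ lev₁ (nabla115 η U)).toLinearMap)
              (frakGLatticeCLM (L := (L : ℝ)) (η := η) (lev₀ := lev₀) φ hposπ hQ lev₁ (nabla115 η U) f) -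
            frakGLatticeCLM (L := (L : ℝ)) (η := η) (lev₀ := lev₀) (c := ((η : ℂ))⁻¹)
              (R := adTransportW φ (fun _ : Bond d (towerP L m (n + 1)) => (1 : 𝔸ˣ)))
              (S := adTransportW φ fun _ : Bond d (towerP L m (n + 1)) => (1 : 𝔸ˣ)⁻¹) (Δ₁ := hessOp φ η (fun _ : Bond d (towerP L m (n + 1)) => (1 : 𝔸ˣ)) τ)
              (Rr := RofUk L m n φ η (fun _ : Bond d (towerP L m (n + 1)) => (1 : 𝔸ˣ)))
              (Q := (QkW L m n φ (fun _ : Bond d (towerP L m (n + 1)) => (1 : 𝔸ˣ)) hL (fun _ => 0) (fun _ => by norm_num)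
                (perCfg_UlevOf_one_mem_U1 L m (n + 1)) (norm_Wcx_UlevOf_one_sub_one_le L m (n + 1) (fun _ => 0) (fun _ => le_rfl)) (c₀ := c₀) (c₁ := c₁))) (a := a)
              φ hpos₁ hQ1 lev₁ (nabla115 η (fun _ : Bond d (towerP L m (n + 1)) => (1 : 𝔸ˣ))) f‖ ≤
            max ((NegSup.wSup (levWeight (L : ℝ) η lev₀ 1) : ℝ) * (Mφ * ((j₀ + α) * K) * Mφ')) (NegSup.wSup (levWeight (L : ℝ) η lev₁ 2) * (Mφ * ((j₀ + α) * KD) * Mφ')) *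
              NegSup.wInvSup (levWeight (L : ℝ) η lev₀ 3) * ‖f‖ :=
  exists_frakGkPi_letterDefect_at_flat_of_thirdWordGradLetter hd L hL hL3 φ hMφ hMφ' hφ hφ' hstar ha ha' hϱ0 hϱ1 τ hτ hCτ hτm hMτ hρw hτ₁ hτ₂ hφτ AQ b hM₂ hrepr (exists_gradLetter_thirdWordPi_sub_flat_of_omegaHolder hd L hL hL3 φ hMφ hMφ' hφ hφ' hstar ha ha' hϱ0 hϱ1 τ hτ hCτ hτm hMτ hρw hτ₁ hτ₂ hφτ AQ b hM₂ hrepr Hω)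

end Literature.MathematicalPhysics.QuantumFieldTheory.Balaban1983to89.B11Eq117FrakGkPiLetterDefectAtFlatOfOmegaHolder

end
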